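import Mathlib
import HarnessLib
import Summits.AtomisticToContinuum.FouriersLaw.Theses.StaticAbelianSqueeze

/-!
# Birth skeleton (BC3) for crux `StaticAbelianSqueeze.UniformAbelianRegularity`
(item `stmt-AtomisticToContinuum-13416`, route `route-AtomisticToContinuum-StaticAbelianSqueeze`, rank-2 crux (R);
sub-problem `FouriersLaw`; registrar `planner-skel-stmt-AtomisticToContinuum-13416-0`, 2026-08-17)

Crux (FIXED, concluded BY NAME below). For `pinnedChain ω₂ lam β γ` (all `> 0`) and `T > 0`, with
`J = Σ_i bondCurrent N i`, `μ_N = gibbsMeasure N T`, `P_t = transitionKernel N T T t` (both baths at `T`) and the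
equilibrium total-current autocorrelation `c_N(t) = ∫ J · (P_t J) dμ_N`:
`∀ ε > 0 ∃ ν₀ > 0 ∀ ν ∈ (0, ν₀)`, eventually in `N`, `|∫₀^∞ (1 − e^{−νt}) c_N(t) dt| ≤ ε N` — the slow
(low-frequency) part of the open chain's current spectral weight is `o(N)` uniformly (sharp HasBoundedResponse, Abelian form).

## Line `birth` — EARLY/LATE TIME SPLIT at an `N`-independent horizon (time-domain engine for (R))

The Abel deficit weight `1 − e^{−νt}` is `≤ νt` for small times and `≤ 1` always. Cut `(0, ∞) = (0, τ] ∪ (τ, ∞)` at an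
`N`-INDEPENDENT horizon `τ = τ(ε)`:

* `stub_equalTimeBound` (EARLY / norm bound, size M): `∃ C ∃ N₀ ∀ N ≥ N₀ ∀ t > 0, |c_N(t)| ≤ C·N` — the autocorrelation never
  exceeds a multiple of the chain length. Mechanism: Gibbs invariance of the constructed kernels (support item
  `GibbsKernelInvariant`, stmt-13421) makes `P_t` an `L²(μ_N)`-contraction, so `|c_N(t)| ≤ ‖J‖²_{L²(μ_N)}`; momenta are
  independent centred Gaussians under `μ_N` given positions and `j_i = −½(p_i+p_{i+1})V′(q_{i+1}−q_i)`, so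
  `Cov(j_i, j_k) = 0` for `|i−k| ≥ 2` and `‖J‖² ≤ 3N·max_i Var(j_i)`, with one-bond Gibbs moments bounded uniformly in `N`
  (transfer operator of the 1-D chain). Not the crux: it says nothing about decay in `t`.
* `stub_uniformL1Tail` (LATE / `N`-uniform integrable tail, size XL — the load-bearing stub): `∀ ε > 0 ∃ τ > 0 ∃ N₀ ∀ N ≥ N₀`,
  `c_N ∈ L¹(0, ∞)` and `∫_τ^∞ |c_N(t)| dt ≤ ε·N` — per unit length, the absolute autocorrelation mass beyond time `τ` is
  uniformly small. Fixed-`N` integrability is in tree in substance (first conjunct of the PROVED item `KuboAbelIdentity`);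
  the `N`-uniformity of the tail is the transport content: bulk Green–Kubo decay on `[τ, N/v]` (`c_N(t)/N ≈ C_T(t)`) plus
  memory loss of the thermostatted chain beyond. It is sign-blind (no cancellations used), hence STRONGER in kind than the
  integrated, signed estimate (R) — the honest strengthening that dynamical tools (hypocoercive decay, coupling, fluctuating
  hydrodynamics: `|c_N(t)| ≲ N|C_T(t)| + O(t^{-3/2})` contact term) would deliver; it fails if slow modes carry `≳ N` weight.
* COMPOSITION `UniformAbelianRegularity_of : stub₁-sig → stub₂-sig → UniformAbelianRegularity` (kernel-checked, no sorry of
  its own): with `τ, N₀` from the tail stub at `ε/2` and `C' = max C 1` from the early stub, take `ν₀ = ε / (2(C'τ² + 1))`;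
  for `ν < ν₀` and large `N`, `|∫₀^∞(1−e^{−νt})c_N| ≤ ∫_{(0,τ]} νt·C'N + ∫_{(τ,∞)} |c_N| ≤ ντ²C'N + εN/2 ≤ εN`
  (abstract lemma `abel_deficit_le`: splitting of the Bochner set integral, `norm_setIntegral_le_of_norm_le_const` on
  `(0, τ]`, `norm_integral_le_integral_norm` + monotonicity on `(τ, ∞)`).

Why the cut is not a costume: the early stub alone gives `|∫(1−e^{−νt})c_N| ≤ ∞` (no decay); the tail stub alone leaves
`∫_{(0,τ]}|c_N|` with unknown growth in `N` while `ν₀` must be chosen before `N`; neither implies (R) or `FouriersLaw` by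
`exact? | simpa | aesop` (BC3 probes, planner folder `bc/`, quoted in `Lines/birth.md`). The strategist census of the twin crux
(`Cruxes/AbelThermodynamicLimit/STRATEGY-CENSUS.md` §Decomposition D8/D9) records this early/late cut and where its difficulty
lives (`N^a ≲ t ≲ N^{1+b}`); this file is its typed, kernel-checked form on the item itself, which had no skeleton.
Disproof used: none on file for stmt-13416 (no `Cruxes/UniformAbelianRegularity/` directory before this line; negatives index:
no FouriersLaw entry bearing on (R)).
-/

noncomputable section

namespace Summit.AtomisticToContinuum.FouriersLaw.Cruxes.UniformAbelianRegularity

namespace Birth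

open MeasureTheory Set

/-! ## The two registered stubs -/

/-- **stub 1 — `stub_equalTimeBound` (EARLY: `N`-linear norm bound on the equilibrium current autocorrelation).**
For `pinnedChain ω₂ lam β γ` (all `> 0`) and `T > 0` there are `C` and `N₀` such that for all `N ≥ N₀` and `t > 0`,
`|c_N(t)| = |∫ J·(P_t J) dμ_N| ≤ C·N`. Engine: `P_t` is an `L²(gibbsMeasure N T)`-contraction once the Gibbs measure is
kernel-invariant (item `GibbsKernelInvariant`), and `‖J‖²_{L²(μ_N)} = Σ_{|i−k|≤1} Cov(j_i, j_k) = O(N)` (momenta independent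
Gaussians given positions; `N`-uniform one-bond moments). Size M. -/
theorem stub_equalTimeBound :
    ∀ ω₂ lam β γ : ℝ, 0 < ω₂ → 0 < lam → 0 < β → 0 < γ → ∀ T : ℝ, 0 < T → ∃ C : ℝ, ∃ N₀ : ℕ, ∀ N : ℕ, N₀ ≤ N → ∀ t : ℝ, 0 < t → let J : Literature.MathematicalPhysics.KineticTheory.HeatConduction.PhaseSpace N → ℝ := fun z => ∑ i : Fin N, (Literature.MathematicalPhysics.KineticTheory.HeatConduction.pinnedChain ω₂ lam β γ).bondCurrent N i z; |∫ z, J z * (∫ y, J y ∂((Literature.MathematicalPhysics.KineticTheory.HeatConduction.pinnedChain ω₂ lam β γ).transitionKernel N T T t.toNNReal z)) ∂((Literature.MathematicalPhysics.KineticTheory.HeatConduction.pinnedChain ω₂ lam β γ).gibbsMeasure N T)| ≤ C * N := by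
  sorry

/-- **stub 2 — `stub_uniformL1Tail` (LATE: `N`-uniform integrable tail of the current autocorrelation per unit length).**
For `pinnedChain ω₂ lam β γ` (all `> 0`) and `T > 0`: for every `ε > 0` there are `τ > 0` and `N₀` such that for all
`N ≥ N₀`, `t ↦ c_N(t)` is integrable on `(0, ∞)` and `∫_{(τ,∞)} |c_N(t)| dt ≤ ε·N`. The load-bearing stub: uniform-in-`N`
`L¹` decay of `c_N/N` (bulk Green–Kubo decay up to the sound-cone time, thermostat-driven memory loss after). Size XL. -/
theorem stub_uniformL1Tail :
    ∀ ω₂ lam β γ : ℝ, 0 < ω₂ → 0 < lam → 0 < β → 0 < γ → ∀ T : ℝ, 0 < T → ∀ ε : ℝ, 0 < ε → ∃ τ : ℝ, 0 < τ ∧ ∃ N₀ : ℕ, ∀ N : ℕ, N₀ ≤ N → let J : Literature.MathematicalPhysics.KineticTheory.HeatConduction.PhaseSpace N → ℝ := fun z => ∑ i : Fin N, (Literature.MathematicalPhysics.KineticTheory.HeatConduction.pinnedChain ω₂ lam β γ).bondCurrent N i z; MeasureTheory.IntegrableOn (fun t : ℝ => ∫ z, J z * (∫ y, J y ∂((Literature.MathematicalPhysics.KineticTheory.HeatConduction.pinnedChain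 ω₂ lam β γ).transitionKernel N T T t.toNNReal z)) ∂((Literature.MathematicalPhysics.KineticTheory.HeatConduction.pinnedChain ω₂ lam β γ).gibbsMeasure N T)) (Set.Ioi 0) ∧ (∫ t in Set.Ioi τ, |∫ z, J z * (∫ y, J y ∂((Literature.MathematicalPhysics.KineticTheory.HeatConduction.pinnedChain ω₂ lam β γ).transitionKernel N T T t.toNNReal z)) ∂((Literature.MathematicalPhysics.KineticTheory.HeatConduction.pinnedChain ω₂ lam β γ).gibbsMeasure N T)|) ≤ ε * N := by
  sorry

/-! ## Glue — elementary real analysis (no `sorry`) -/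

/-- **The Abel-deficit estimate, abstract form.** If `c ∈ L¹(0,∞)`, `|c| ≤ C` on `(0,∞)` and `∫_{(τ,∞)} |c| ≤ B`, then for
`ν, τ > 0`: `|∫_{(0,∞)} (1 − e^{−νt}) c(t) dt| ≤ ν τ² C + B` — split at `τ`, use `0 ≤ 1 − e^{−νt} ≤ min(νt, 1)`. [folklore] -/
theorem abel_deficit_le {c : ℝ → ℝ} {ν τ C B : ℝ} (hν : 0 < ν) (hτ : 0 < τ) (hC : 0 ≤ C)
    (hint : IntegrableOn c (Ioi 0))
    (hbound : ∀ t : ℝ, 0 < t → |c t| ≤ C)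
    (htail : (∫ t in Ioi τ, |c t|) ≤ B) :
    |∫ t in Ioi (0:ℝ), (1 - Real.exp (-(ν * t))) * c t| ≤ ν * τ ^ 2 * C + B := by
  -- the weight `w(t) = 1 - e^{-νt}`: `0 ≤ w ≤ 1` and `w(t) ≤ νt` on `(0, ∞)`
  have hw0 : ∀ t : ℝ, 0 < t → 0 ≤ 1 - Real.exp (-(ν * t)) := fun t ht => by
    have h : Real.exp (-(ν * t)) ≤ 1 :=
      Real.exp_le_one_iff.2 (by nlinarith [mul_pos hν ht])
    linarith
  have hw1 : ∀ t : ℝ, 0 < t → 1 - Real.exp (-(ν * t)) ≤ 1 := fun t _ => by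
    linarith [Real.exp_pos (-(ν * t))]
  have hwlin : ∀ t : ℝ, 0 < t → 1 - Real.exp (-(ν * t)) ≤ ν * t := fun t _ => by
    linarith [Real.add_one_le_exp (-(ν * t))]
  -- integrability of the weighted autocorrelation on `(0, ∞)`
  have hcont : Continuous fun t : ℝ => 1 - Real.exp (-(ν * t)) := by fun_prop
  have hf_int : IntegrableOn (fun t : ℝ => (1 - Real.exp (-(ν * t))) * c t) (Ioi 0) := by
    refine Integrable.mono hint (hcont.aestronglyMeasurable.mul hint.aestronglyMeasurable) ?_
    refine (ae_restrict_iff' measurableSet_Ioi).2 (Filter.Eventually.of_forall fun t ht => ?_)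
    rw [norm_mul, Real.norm_eq_abs, abs_of_nonneg (hw0 t ht)]
    exact mul_le_of_le_one_left (norm_nonneg _) (hw1 t ht)
  -- split `(0, ∞) = (0, τ] ∪ (τ, ∞)`
  have hsplit : ∫ t in Ioi (0:ℝ), (1 - Real.exp (-(ν * t))) * c t =
      (∫ t in Ioc (0:ℝ) τ, (1 - Real.exp (-(ν * t))) * c t) +
        ∫ t in Ioi τ, (1 - Real.exp (-(ν * t))) * c t := by
    rw [← Ioc_union_Ioi_eq_Ioi hτ.le]
    exact setIntegral_union (Ioc_disjoint_Ioi le_rfl) measurableSet_Ioi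
      (hf_int.mono_set Ioc_subset_Ioi_self) (hf_int.mono_set (Ioi_subset_Ioi hτ.le))
  -- EARLY piece: `‖∫_{(0,τ]} w c‖ ≤ (ν τ C) · |(0, τ]| = ν τ² C`
  have hearly : ‖∫ t in Ioc (0:ℝ) τ, (1 - Real.exp (-(ν * t))) * c t‖ ≤ ν * τ * C * τ := by
    have h := norm_setIntegral_le_of_norm_le_const (μ := (volume : Measure ℝ)) (s := Ioc (0:ℝ) τ)
      (f := fun t : ℝ => (1 - Real.exp (-(ν * t))) * c t) (C := ν * τ * C) measure_Ioc_lt_top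
      (fun t ht => by
        rw [Real.norm_eq_abs, abs_mul, abs_of_nonneg (hw0 t ht.1)]
        calc (1 - Real.exp (-(ν * t))) * |c t| ≤ (ν * t) * C :=
              mul_le_mul (hwlin t ht.1) (hbound t ht.1) (abs_nonneg _) (by nlinarith [ht.1])
          _ ≤ ν * τ * C := mul_le_mul_of_nonneg_right (mul_le_mul_of_nonneg_left ht.2 hν.le) hC)
    rwa [Real.volume_real_Ioc_of_le hτ.le, sub_zero] at h
  -- LATE piece: `‖∫_{(τ,∞)} w c‖ ≤ ∫_{(τ,∞)} |c| ≤ B`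
  have hlate : ‖∫ t in Ioi τ, (1 - Real.exp (-(ν * t))) * c t‖ ≤ B := by
    calc ‖∫ t in Ioi τ, (1 - Real.exp (-(ν * t))) * c t‖
          ≤ ∫ t in Ioi τ, ‖(1 - Real.exp (-(ν * t))) * c t‖ := norm_integral_le_integral_norm _
      _ ≤ ∫ t in Ioi τ, |c t| := by
          refine setIntegral_mono_on (hf_int.mono_set (Ioi_subset_Ioi hτ.le)).norm
            (hint.mono_set (Ioi_subset_Ioi hτ.le)).abs measurableSet_Ioi fun t ht => ?_
          have ht0 : 0 < t := lt_trans hτ ht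
          rw [norm_mul, Real.norm_eq_abs, Real.norm_eq_abs, abs_of_nonneg (hw0 t ht0)]
          exact mul_le_of_le_one_left (abs_nonneg _) (hw1 t ht0)
      _ ≤ B := htail
  -- assemble
  rw [← Real.norm_eq_abs, hsplit]
  calc ‖(∫ t in Ioc (0:ℝ) τ, (1 - Real.exp (-(ν * t))) * c t) + ∫ t in Ioi τ, (1 - Real.exp (-(ν * t))) * c t‖
        ≤ ‖∫ t in Ioc (0:ℝ) τ, (1 - Real.exp (-(ν * t))) * c t‖ + ‖∫ t in Ioi τ, (1 - Real.exp (-(ν * t))) * c t‖ :=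
          norm_add_le _ _
    _ ≤ ν * τ * C * τ + B := add_le_add hearly hlate
    _ = ν * τ ^ 2 * C + B := by ring

/-! ## The composition -/

/-- **The implication, sorry-free** (axioms `propext`, `Classical.choice`, `Quot.sound`):
`stub_equalTimeBound`-statement → `stub_uniformL1Tail`-statement → `StaticAbelianSqueeze.UniformAbelianRegularity` BY NAME.
Given `ε`: `τ, N₂` from the tail stub at `ε/2`, `C, N₁` from the early stub, `C' = max C 1`, `ν₀ = ε/(2(C'τ²+1))`;
for `0 < ν < ν₀` and `N ≥ max N₁ N₂`, `abel_deficit_le` gives `|∫₀^∞(1−e^{−νt})c_N| ≤ ντ²C'N + εN/2 ≤ εN`. -/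
theorem UniformAbelianRegularity_of :
    (∀ ω₂ lam β γ : ℝ, 0 < ω₂ → 0 < lam → 0 < β → 0 < γ → ∀ T : ℝ, 0 < T → ∃ C : ℝ, ∃ N₀ : ℕ, ∀ N : ℕ, N₀ ≤ N → ∀ t : ℝ, 0 < t → let J : Literature.MathematicalPhysics.KineticTheory.HeatConduction.PhaseSpace N → ℝ := fun z => ∑ i : Fin N, (Literature.MathematicalPhysics.KineticTheory.HeatConduction.pinnedChain ω₂ lam β γ).bondCurrent N i z; |∫ z, J z * (∫ y, J y ∂((Literature.MathematicalPhysics.KineticTheory.HeatConduction.pinnedChain ω₂ lam β γ).transitionKernel N T T t.toNNReal z)) ∂((Literature.MathematicalPhysics.KineticTheory.HeatConduction.pinnedChain ω₂ lam β γ).gibbsMeasure N T)| ≤ C * N) →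
    (∀ ω₂ lam β γ : ℝ, 0 < ω₂ → 0 < lam → 0 < β → 0 < γ → ∀ T : ℝ, 0 < T → ∀ ε : ℝ, 0 < ε → ∃ τ : ℝ, 0 < τ ∧ ∃ N₀ : ℕ, ∀ N : ℕ, N₀ ≤ N → let J : Literature.MathematicalPhysics.KineticTheory.HeatConduction.PhaseSpace N → ℝ := fun z => ∑ i : Fin N, (Literature.MathematicalPhysics.KineticTheory.HeatConduction.pinnedChain ω₂ lam β γ).bondCurrent N i z; MeasureTheory.IntegrableOn (fun t : ℝ => ∫ z, J z * (∫ y, J y ∂((Literature.MathematicalPhysics.KineticTheory.HeatConduction.pinnedChain ω₂ lam β γ).transitionKernel N T T t.toNNReal z)) ∂((Literature.MathematicalPhysics.KineticTheory.HeatConduction.pinnedChain ω₂ lam β γ).gibbsMeasure N T)) (Set.Ioi 0) ∧ (∫ t in Set.Ioi τ, |∫ z, J z * (∫ y, J y ∂((Literature.MathematicalPhysics.KineticTheory.HeatConduction.pinnedChain ω₂ lam β γ).transitionKernel N T T t.toNNReal z)) ∂((Literature.MathematicalPhysics.KineticTheory.HeatConduction.pinnedChain ω₂ lam β γ).gibbsMeasure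 N T)|) ≤ ε * N) →
    _root_.Summit.AtomisticToContinuum.FouriersLaw.Theses.StaticAbelianSqueeze.UniformAbelianRegularity := by
  intro h1 h2 ω₂ lam β γ hω hl hβ hγ T hT ε hε
  obtain ⟨C, N₁, hC⟩ := h1 ω₂ lam β γ hω hl hβ hγ T hT
  obtain ⟨τ, hτ, N₂, hL⟩ := h2 ω₂ lam β γ hω hl hβ hγ T hT (ε / 2) (half_pos hε)
  have hC' : 0 < max C 1 := lt_of_lt_of_le one_pos (le_max_right _ _)
  have hden : 0 < 2 * (max C 1 * τ ^ 2 + 1) := by positivity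
  refine ⟨ε / (2 * (max C 1 * τ ^ 2 + 1)), div_pos hε hden, fun ν hν hνlt => ⟨max N₁ N₂, fun N hN => ?_⟩⟩
  have hN1 : N₁ ≤ N := le_trans (le_max_left _ _) hN
  have hN2 : N₂ ≤ N := le_trans (le_max_right _ _) hN
  have hN0 : (0:ℝ) ≤ N := Nat.cast_nonneg N
  intro J
  have hint : MeasureTheory.IntegrableOn (fun t : ℝ => ∫ z, J z * (∫ y, J y ∂((Literature.MathematicalPhysics.KineticTheory.HeatConduction.pinnedChain ω₂ lam β γ).transitionKernel N T T t.toNNReal z)) ∂((Literature.MathematicalPhysics.KineticTheory.HeatConduction.pinnedChain ω₂ lam β γ).gibbsMeasure N T)) (Set.Ioi 0) := (hL N hN2).1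
  have htail : (∫ t in Set.Ioi τ, |∫ z, J z * (∫ y, J y ∂((Literature.MathematicalPhysics.KineticTheory.HeatConduction.pinnedChain ω₂ lam β γ).transitionKernel N T T t.toNNReal z)) ∂((Literature.MathematicalPhysics.KineticTheory.HeatConduction.pinnedChain ω₂ lam β γ).gibbsMeasure N T)|) ≤ ε / 2 * N := (hL N hN2).2
  have hbound : ∀ t : ℝ, 0 < t → |∫ z, J z * (∫ y, J y ∂((Literature.MathematicalPhysics.KineticTheory.HeatConduction.pinnedChain ω₂ lam β γ).transitionKernel N T T t.toNNReal z)) ∂((Literature.MathematicalPhysics.KineticTheory.HeatConduction.pinnedChain ω₂ lam β γ).gibbsMeasure N T)| ≤ max C 1 * N := fun t ht =>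
    le_trans (hC N hN1 t ht) (mul_le_mul_of_nonneg_right (le_max_left _ _) hN0)
  have key := abel_deficit_le (c := fun t : ℝ => ∫ z, J z * (∫ y, J y ∂((Literature.MathematicalPhysics.KineticTheory.HeatConduction.pinnedChain ω₂ lam β γ).transitionKernel N T T t.toNNReal z)) ∂((Literature.MathematicalPhysics.KineticTheory.HeatConduction.pinnedChain ω₂ lam β γ).gibbsMeasure N T)) hν hτ (mul_nonneg hC'.le hN0) hint hbound htail
  refine le_trans key ?_
  -- arithmetic: `ν τ² C' N + ε N / 2 ≤ ε N` because `ν (C' τ² + 1) < ε / 2`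
  have hν2 : ν * (2 * (max C 1 * τ ^ 2 + 1)) < ε := (lt_div_iff₀ hden).1 hνlt
  have h4 : ν * τ ^ 2 * max C 1 ≤ ε / 2 := by nlinarith [hν.le]
  have h5 : ν * τ ^ 2 * (max C 1 * (N : ℝ)) ≤ ε / 2 * N := by
    calc ν * τ ^ 2 * (max C 1 * (N : ℝ)) = (ν * τ ^ 2 * max C 1) * N := by ring
      _ ≤ ε / 2 * N := mul_le_mul_of_nonneg_right h4 hN0
  linarith

/-- **Skeleton theorem — the crux BY NAME from the two registered stubs** (open exactly through their `sorryAx`;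
the seam `UniformAbelianRegularity_of` is sorry-free). -/
theorem UniformAbelianRegularity_skeleton :
    _root_.Summit.AtomisticToContinuum.FouriersLaw.Theses.StaticAbelianSqueeze.UniformAbelianRegularity :=
  UniformAbelianRegularity_of stub_equalTimeBound stub_uniformL1Tail

end Birth

end Summit.AtomisticToContinuum.FouriersLaw.Cruxes.UniformAbelianRegularity

end
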